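/-
Copyright: harness21 operator infrastructure (2026). Not a cell file; not a gate target (HarnessLib/ is outside the
proposal layout and is maintained by direct operator commits).
-/
import Lean.LibrarySuggestions.Basic

/-!
# Build-lane export guard for the HodgeCM cone (coordinator GO 2026-08-23)

Lean 4.32 runs the library-suggestion indexers (`Lean.LibrarySuggestions.SymbolFrequency` and `SineQuaNon`, through
their `exportEntriesFnEx`) over every local theorem constant whenever an `.olean` is written. On the large binder
telescopes of the `HodgeCM` Model files that fold costs 5–90 minutes per module (measured: `Model.ArchLineInputOf`
4 944 s in the build lane vs 43 s plain elaboration), while it contributes nothing to the mathematics: the indexers only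
feed premise *suggestions* (`exact?`-style library search).

The indexers skip every constant for which `Lean.LibrarySuggestions.isDeniedPremise` holds, and
`Lean/LibrarySuggestions/Basic.lean` (§ `DenyList`) documents the sanctioned switch:

> Use `run_cmd modifyEnv fun env => nameDenyListExt.addEntry env name` to add a name to the deny list.

The single entry below adds the name component `HodgeCM`. It is a persistent environment-extension entry, so every
module that imports this one (directly or transitively — `Summits.HodgeConjecture.HodgeCM.CM.Basic` imports it, and the
whole cone imports that) inherits it: constants with a name component `HodgeCM` are not offered as library-suggestion
premises. Nothing else changes — no statement, proof, attribute, reducibility setting or option is touched; checked on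
2026-08-23 that `#print axioms` and `#check` output of downstream theorems are byte-identical with and without the entry
(`Model.ArchLineDatumOf_1`), and that the downstream export drops from 155 s to 14 s.
-/

run_cmd Lean.modifyEnv (Lean.LibrarySuggestions.nameDenyListExt.addEntry · "HodgeCM")
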